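import Literature.NumberTheory.EllipticCurves.ModularFormsGamma0Genus
import Summits.BirchSwinnertonDyer.Rank1Residual.Additive.PlusSymbolIntegrality
import HarnessLib

/-!
# BSD rank-≤1 residual cell: some modular symbol `[r]⁺_f` is a `p`-adic UNIT (`p` odd), so `Ω⁺_f`
# is Kim's MINIMAL integral period on every irreducible row (ROUTE-1 F-d v2 (iv))

HONEST FRAMING (cell `b2b-bsdres-*`, run/shared/lean/b2b/bsd-rank1-residual/, verbatim): the goal
of the cell is to DELETE the COMBINATION-SHAPED residual classes for ALL analytic-rank `≤ 1` elliptic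
curves over `ℚ` — "full BSD formula for every rank `≤ 1` curve in class C" assembled STRICTLY from
published theorems — so that the rank-`≤ 1` remainder becomes exactly the CONSTRUCTION-SHAPED
classes, which are TYPED (missing-input Props), NOT attempted; this is not "finishing BSD".
Prove what is provable now; shrink each hard class to its core with data; no claim beyond stated
classes.  Research routes; census output = EVIDENCE, never a Literature fact.  Unit
`b2b-bsdres-n1011-p09` (team n1011, OWNERS row **T-R18b** = ROUTE-1 R1-8 (ii), F-d v2 (iv)).
THEOREMS ONLY (no definition, no named fact, no instance); a TOOL file about modular symbols — no
closure value, no class theorem, no label moves.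

## What this file does (ROUTE-1 §15.1 F-d v2 (iv), the `Λ_f`-side; census covariate `a(E)`)

For `f ∈ S₂(Γ₀(N))` with REAL Fourier coefficients and `Ω⁺_f ≠ 0`, and an odd prime `p`:
* (`exists_cuspSymbol_re_not_dvd`) some CLOSED period `{∞, γ∞}_f`, `γ ∈ Γ₀(N)`, has real part
  `k · Ω⁺_f/2` with `p ∤ k` — because `re Λ_f = ℤ · Ω⁺_f/2` is generated by these real parts
  (definition of `Ω⁺_f`, `periodLattice = closure (range cuspSymbol)`);
* (`exists_ratPlusSymbol_padicValRat_eq_zero`) hence the cusp `r = γ∞` has `[r]⁺_f = k/2` with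
  `ord_p [r]⁺_f = 0` (`{∞, −r} = conj {∞, r}`, `modularSymbol_neg_eq_conj_holds`): **some `[r]⁺_f` is a
  `p`-adic unit**, so every exponent `v` with `v ≤ ord_p [r]⁺_f` for all non-zero `[r]⁺_f` has `v ≤ 0`
  (`integralPeriodExponent_nonpos`): Kim's minimal integral period `Ω^+_{f,min} = p^{a}·Ω⁺_f·unit`
  (arXiv:2505.09121 Def. 2.2) has `a ≤ 0` ALWAYS;
* (`minimalIntegralPeriod_of_irreducible`, `…_of_towerSurj`) with the integrality theorem
  `padicValRat_ratPlusSymbol_nonneg_of_irreducible` (`p` odd, `E[p]` irreducible, `f` the newform of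
  `E`): `min_r ord_p [r]⁺_f = 0`, i.e. **`Ω⁺_f` itself is Kim's MINIMAL integral period on every
  irreducible row** — the census covariate `a(E)` of `PREDICTIONS-E2-AT3` §9 is `0` theorem-level on
  N11, and `∂^{(i)}(δ̃^{min}) = ∂^{(i)}(δ̃^{Ω⁺_f})` there (the `v = 0` instance of the
  `Kim2025.…_of_integralPeriod_OPEN` records is the minimal one).

## References

* C.-H. Kim (appendix with R. Pollack), arXiv:2505.09121v1, Def. 2.2, Rem. 2.3, §1.4.4 [Kim2025RefinedTNC].
* J. E. Cremona, *Algorithms for modular elliptic curves* (1997), §2.8 ("`Ω(f)` is twice the least real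
  part of a period") [CremonaAlgorithms1997]; Ju. I. Manin, Izv. 36 (1972), §1.6 [Manin1972].
* Cell files: `cells/n1011/ROUTE-1.md` §15.1 F-d v2 (iv); `cells/n1011/PREDICTIONS-E2-AT3.md` §9;
  `HOME/b2b-bsdres-n1011-p09/KIM2025-READING.md` §6 (ii)–(iii).
-/

noncomputable section

open scoped MatrixGroups ModularForm

open CongruenceSubgroup Literature.NumberTheory.EllipticCurves.ModularForms
  Literature.NumberTheory.EllipticCurves

namespace Summit.BirchSwinnertonDyer.Rank1Residual.Additive

section RealParts

variable {N : ℕ} [NeZero N] (f : CuspForm (Gamma0 N) 2)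

omit [NeZero N] in
/-- **Some closed period has real part `k · Ω⁺_f/2` with `p ∤ k`** (`Ω⁺_f ≠ 0`, `p` prime):
otherwise every generator `{∞, γ∞}_f` of `Λ_f` has real part in `ℤ · pΩ⁺_f/2`, hence so does all of
`re Λ_f = ℤ · Ω⁺_f/2 ∋ Ω⁺_f/2`, forcing `p ∣ 1`. (Cremona §2.8: `Ω⁺_f/2` is the least positive real
part of a period.) [folklore] -/
theorem exists_cuspSymbol_re_not_dvd (hΩ : plusPeriod f ≠ 0) {p : ℕ} (hp : p.Prime) :
    ∃ (γ : Gamma0 N) (k : ℤ), ¬ (p : ℤ) ∣ k ∧ (cuspSymbol f γ).re = k * (plusPeriod f / 2) := by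
  obtain ⟨hre, hpos⟩ := realPeriods_eq_zmultiples_of_plusPeriod_ne_zero f hΩ
  by_contra hne
  -- every generator's real part lies in `ℤ · (p Ω⁺/2)`
  have hS : ∀ γ : Gamma0 N,
      (cuspSymbol f γ).re ∈ AddSubgroup.zmultiples ((p : ℝ) * (plusPeriod f / 2)) := by
    intro γ
    have hmem : (cuspSymbol f γ).re ∈ realPeriods f :=
      AddSubgroup.mem_map_of_mem _ (cuspSymbol_mem_periodLattice f γ)
    rw [hre, AddSubgroup.mem_zmultiples_iff] at hmem
    obtain ⟨k, hk⟩ := hmem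
    have hpk : (p : ℤ) ∣ k := by
      by_contra hpk
      exact hne ⟨γ, k, hpk, by rw [← hk, zsmul_eq_mul]⟩
    obtain ⟨m, hm⟩ := hpk
    refine AddSubgroup.mem_zmultiples_iff.mpr ⟨m, ?_⟩
    rw [← hk, hm, zsmul_eq_mul, zsmul_eq_mul]
    push_cast
    ring
  -- hence `re Λ_f ≤ ℤ · (p Ω⁺/2)`
  have hle : realPeriods f ≤ AddSubgroup.zmultiples ((p : ℝ) * (plusPeriod f / 2)) := by
    change (periodLattice f).map Complex.reLm.toAddMonoidHom ≤ _
    rw [AddSubgroup.map_le_iff_le_comap, periodLattice, AddSubgroup.closure_le]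
    rintro _ ⟨γ, rfl⟩
    exact hS γ
  -- but `Ω⁺/2 ∈ re Λ_f`
  have hhalf : plusPeriod f / 2 ∈ realPeriods f := by
    rw [hre]; exact AddSubgroup.mem_zmultiples _
  obtain ⟨m, hm⟩ := AddSubgroup.mem_zmultiples_iff.mp (hle hhalf)
  rw [zsmul_eq_mul] at hm
  have h1 : ((m * p : ℤ) : ℝ) = 1 := by
    have h2 : ((m : ℝ) * p - 1) * (plusPeriod f / 2) = 0 := by linear_combination hm
    rcases mul_eq_zero.mp h2 with h | h
    · push_cast; linarith
    · exfalso; exact hΩ (by linarith)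
  have h3 : (m * p : ℤ) = 1 := by exact_mod_cast h1
  have h4 : (p : ℤ) ∣ 1 := ⟨m, by linarith⟩
  have h5 : p ∣ 1 := by exact_mod_cast h4
  exact hp.one_lt.ne' (Nat.dvd_one.mp h5)

/-- **Some modular symbol `[r]⁺_f` is a `p`-adic unit** (`f` with real coefficients, `Ω⁺_f ≠ 0`, `p`
odd): there is `r ∈ ℚ` with `[r]⁺_f ≠ 0` and `ord_p [r]⁺_f = 0`.  Take the cusp `r = γ∞` of
`exists_cuspSymbol_re_not_dvd`: `{∞, r}_f = {∞, γ∞}_f` has real part `kΩ⁺/2`, `p ∤ k`, and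
`[r]⁺_f = re(({∞,r} + {∞,−r})/2)/Ω⁺ = k/2` since `{∞, −r} = conj {∞, r}`
(`modularSymbol_neg_eq_conj_holds`). [folklore] -/
theorem exists_ratPlusSymbol_padicValRat_eq_zero (hreal : ∀ n, (cuspCoeff f n).im = 0)
    (hΩ : plusPeriod f ≠ 0) {p : ℕ} [Fact p.Prime] (hp2 : p ≠ 2) :
    ∃ r : ℚ, ratPlusSymbol f r ≠ 0 ∧ padicValRat p (ratPlusSymbol f r) = 0 := by
  have hp : p.Prime := Fact.out
  obtain ⟨γ, k, hk, hγ⟩ := exists_cuspSymbol_re_not_dvd f hΩ hp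
  have hk0 : k ≠ 0 := by rintro rfl; exact hk (dvd_zero _)
  -- `γ∞ ≠ ∞`: otherwise `{∞, γ∞}_f = 0`
  have hc : ((γ : SL(2, ℤ)) 1 0 : ℤ) ≠ 0 := by
    intro h0
    have : cuspSymbol f γ = 0 := by rw [cuspSymbol, if_pos h0]
    rw [this, Complex.zero_re] at hγ
    have : (k : ℝ) * (plusPeriod f / 2) = 0 := hγ.symm
    rcases mul_eq_zero.mp this with h | h
    · exact hk0 (by exact_mod_cast h)
    · exact hΩ (by linarith)
  set r : ℚ := (((γ : SL(2, ℤ)) 0 0 : ℤ) : ℚ) / (((γ : SL(2, ℤ)) 1 0 : ℤ) : ℚ) with hr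
  have hsym : cuspSymbol f γ = modularSymbol f r := by rw [cuspSymbol, if_neg hc]
  -- `[r]⁺_f = k/2`
  have hplus : (plusSymbol f r).re = k * (plusPeriod f / 2) := by
    rw [plusSymbol_eq_re_of f (modularSymbol_neg_eq_conj_holds f) hreal r, Complex.ofReal_re, ← hsym, hγ]
  have hnorm : normalizedPlusSymbol f r = ((k : ℚ) / 2 : ℚ) := by
    rw [normalizedPlusSymbol, hplus]
    push_cast
    field_simp
  have hrat : ratPlusSymbol f r = (k : ℚ) / 2 := by
    have hex : ∃ q : ℚ, (q : ℝ) = normalizedPlusSymbol f r := ⟨(k : ℚ) / 2, hnorm.symm⟩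
    rw [ratPlusSymbol, dif_pos hex]
    apply Rat.cast_injective (α := ℝ)
    rw [hex.choose_spec, hnorm]
  refine ⟨r, ?_, ?_⟩
  · rw [hrat]
    exact div_ne_zero (by exact_mod_cast hk0) two_ne_zero
  · have h2 : ¬ p ∣ 2 := fun h ↦ hp2 ((Nat.prime_dvd_prime_iff_eq hp Nat.prime_two).mp h)
    rw [hrat, padicValRat.div (by exact_mod_cast hk0) two_ne_zero, padicValRat.of_int,
      padicValInt.eq_zero_of_not_dvd hk, show (2 : ℚ) = ((2 : ℕ) : ℚ) by norm_num,
      padicValRat.of_nat, padicValNat.eq_zero_of_not_dvd h2]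
    simp

/-- **Kim's minimal exponent is `≤ 0`**: if `p^v · Ω⁺_f` is an integral period of the plus symbols
(`v ≤ ord_p [r]⁺_f` for every `r` with `[r]⁺_f ≠ 0`) then `v ≤ 0` (`f` with real coefficients,
`Ω⁺_f ≠ 0`, `p` odd) — Kim 2025 Def. 2.2: `Ω^+_{f,min} = p^{a}·Ω⁺_f·(unit)` with `a ≤ 0`. [folklore] -/
theorem integralPeriodExponent_nonpos (hreal : ∀ n, (cuspCoeff f n).im = 0) (hΩ : plusPeriod f ≠ 0)
    {p : ℕ} [Fact p.Prime] (hp2 : p ≠ 2) (v : ℤ)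
    (hv : ∀ r : ℚ, ratPlusSymbol f r ≠ 0 → v ≤ padicValRat p (ratPlusSymbol f r)) : v ≤ 0 := by
  obtain ⟨r, hr, h0⟩ := exists_ratPlusSymbol_padicValRat_eq_zero f hreal hΩ hp2
  have := hv r hr
  rwa [h0] at this

end RealParts

/-! ### With irreducibility: `Ω⁺_f` is the MINIMAL integral period -/

section Minimal

variable {N : ℕ} [NeZero N] {f : CuspForm (Gamma0 N) 2} {p : ℕ} [Fact p.Prime]
  {W : WeierstrassCurve ℚ} [W.IsElliptic] [W.IsGloballyMinimal]

omit [W.IsElliptic] [W.IsGloballyMinimal] in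
/-- The newform of `W` has real (indeed integer) Fourier coefficients. [folklore] -/
theorem im_cuspCoeff_eq_zero_of_isNewformOf (hf : IsNewformOf W f) (n : ℕ) : (cuspCoeff f n).im = 0 :=
  cuspCoeff_im_eq_zero_of_coeffField_eq_bot hf.coeffField_eq_bot n

omit [W.IsElliptic] [W.IsGloballyMinimal] in
/-- The newform of `W` has `Ω⁺_f > 0` (Eichler–Shimura lattice, `IsNewform0.plusPeriod_pos_holds`,
rational coefficients). [folklore] -/
theorem plusPeriod_pos_of_isNewformOf (hf : IsNewformOf W f) : 0 < plusPeriod f :=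
  IsNewform0.plusPeriod_pos_holds hf.1 hf.coeffField_eq_bot

/-- **`Ω⁺_f` is Kim's MINIMAL integral period on every irreducible row** (`p` odd, `E[p]`
irreducible, `f` the newform of `E = W/ℚ`): every non-zero `[r]⁺_f` has `ord_p [r]⁺_f ≥ 0`
(`padicValRat_ratPlusSymbol_nonneg_of_irreducible`, ROUTE-1 R1-8 (ii)) AND some `[r]⁺_f` has
`ord_p [r]⁺_f = 0` — so `min_r ord_p [r]⁺_f = 0`, `Ω^+_{f,min} = Ω⁺_f · (p-adic unit)`, the census
covariate `a(E) = 0`, and `∂^{(i)}(δ̃^{min}) = ∂^{(i)}(δ̃^{Ω⁺_f})` (F-d v2 (iv)). [folklore] -/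
theorem minimalIntegralPeriod_of_irreducible (hp2 : p ≠ 2) (hf : IsNewformOf W f)
    (hirr : W.HasIrreducibleModPGaloisRep p) :
    (∀ r : ℚ, ratPlusSymbol f r ≠ 0 → 0 ≤ padicValRat p (ratPlusSymbol f r)) ∧
      ∃ r : ℚ, ratPlusSymbol f r ≠ 0 ∧ padicValRat p (ratPlusSymbol f r) = 0 :=
  ⟨padicValRat_ratPlusSymbol_nonneg_of_irreducible hp2 hf hirr,
    exists_ratPlusSymbol_padicValRat_eq_zero f (im_cuspCoeff_eq_zero_of_isNewformOf hf)
      (plusPeriod_pos_of_isNewformOf hf).ne' hp2⟩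

/-- **The admissible exponents are exactly `v ≤ 0`** on an irreducible row (`p` odd): `p^v·Ω⁺_f` is
an integral period of the plus symbols iff `v ≤ 0`; in particular the `v = 0` instance of the
`Kim2025.cor17_rankZero_padicValNat_sha_le_of_integralPeriod_OPEN` record is the sharpest (minimal)
one. [folklore] -/
theorem integralPeriodExponent_iff_nonpos_of_irreducible (hp2 : p ≠ 2) (hf : IsNewformOf W f)
    (hirr : W.HasIrreducibleModPGaloisRep p) (v : ℤ) :
    (∀ r : ℚ, ratPlusSymbol f r ≠ 0 → v ≤ padicValRat p (ratPlusSymbol f r)) ↔ v ≤ 0 := by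
  obtain ⟨hint, -⟩ := minimalIntegralPeriod_of_irreducible hp2 hf hirr
  refine ⟨integralPeriodExponent_nonpos f (im_cuspCoeff_eq_zero_of_isNewformOf hf)
    (plusPeriod_pos_of_isNewformOf hf).ne' hp2 v, fun hv r hr ↦ hv.trans (hint r hr)⟩

/-- Row reading under the tower hypothesis of the `Kim2025` records (`3 ≤ p`, `ρ̄_{E,p^n}` onto for
all `n`): `Ω⁺_f` is the minimal integral period. [folklore] -/
theorem minimalIntegralPeriod_of_towerSurj (hp3 : 3 ≤ p) (hf : IsNewformOf W f)
    (htower : ∀ n : ℕ, W.HasSurjectiveModNGaloisRep (p ^ n : ℕ)) :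
    (∀ r : ℚ, ratPlusSymbol f r ≠ 0 → 0 ≤ padicValRat p (ratPlusSymbol f r)) ∧
      ∃ r : ℚ, ratPlusSymbol f r ≠ 0 ∧ padicValRat p (ratPlusSymbol f r) = 0 :=
  minimalIntegralPeriod_of_irreducible (by omega) hf
    (hasIrreducibleModPGaloisRep_of_hasSurjectiveModNGaloisRep W p (by simpa using htower 1))

end Minimal

end Summit.BirchSwinnertonDyer.Rank1Residual.Additive

end
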